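import Mathlib.InformationTheory.KullbackLeibler.Basic
import Mathlib.MeasureTheory.Measure.Tilted
import Literature.MathematicalPhysics.KineticTheory.InfiniteChainDynamics
import HarnessLib

/-!
# States of the infinite oscillator chain: regularity with respect to finite-volume Gibbs references

Topic `Literature/MathematicalPhysics/KineticTheory`; definition request `defn-IsRegularFinVol`
(cone hygiene for the `FouriersLaw` routes of `AtomisticToContinuum`, filed by the route repair
of `route-AtomisticToContinuum-LocalOhmRigidity`, wanted by `stmt-AtomisticToContinuum-2739`).

This file adds ONE notion to the hypothesis-free vocabulary of states `ν` (probability measures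
on `ChainConfig = ℤ → ℝ × ℝ`) of the infinite chain `P : OscillatorChain`: REGULARITY WITH RESPECT
TO THE FREE-BOUNDARY FINITE-VOLUME GIBBS REFERENCES, `OscillatorChain.IsRegularFinVol`, together
with the phase-space box maps `boxPhaseAt` it is built from. The rest of the vocabulary — local
test functions, the Liouville operator and time invariance in generator form, the shift and
shift invariance, box restrictions and marginals, Bernardin's DLR-referenced regularity, Gibbs
mixtures, macro-ergodicity — lives in the sibling hypothesis-free modules of this directory
(`InfiniteChainObservables.lean`, namespace `InfiniteChain`; `InfiniteChainInvariantStates.lean`)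
and, historically, in the barrier file
`Literature/Barriers/AtomisticToContinuum/MacroErgodicityHypothesis.lean`. This file depends on
none of them: it imports only `InfiniteChainDynamics` (hence `FouriersLaw` and the
`GibbsSpecification` cone, all of whose closed named facts are discharged in the tree) and
Mathlib, and where shift invariance is needed it is taken in its unfolded form
`ν.map (fun σ x => σ (x + 1)) = ν`, which is DEFINITIONALLY the `IsShiftInvariant ν` of each of
those modules (their `shift` is `fun σ x => σ (x + 1)`), so their hypotheses can be passed as they
are.

## Sources

* Fritz–Funaki–Lebowitz 1994 (PTRF 99), §2, p. 214: the free-boundary Hamiltonian (2.4)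
  `H⁰_Λ = ∑_{k∈Λ} (p_k²/2 + U(q_k)) + ∑_{bonds in Λ} V(q_k - q_j)`; pp. 216–217: "As a family of
  reference measures we use finite volume Gibbs states `λ_n⁰` with free boundary conditions",
  eq. (2.7) `dλ_n⁰ = exp[F_n⁰ - H⁰_{Λ_n}(ω_{Λ_n})] dω_{Λ_n}`; Definition 2.4: the entropy
  `I[μ|λ] = sup_h {∫ h dμ - log ∫ e^h dλ}`, `I_n[μ] = I_{Λ_n}[μ | λ_n⁰]`, the relative entropy per
  unit volume `Ī[μ] = limsup (2n+1)^{-d} I_n[μ]`, and "`I_n[μ] < +∞` implies that `μ_n ≪ λ_n⁰`".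
* Bernardin 2014 (arXiv:1407.7023), §1.1, p. 4: "A probability measure `ν` is said to be
  `μ`-regular if for any finite box `Λ ⊂ ℤᵈ` … the relative entropy of `ν|_Λ` w.r.t. `μ|_Λ` is
  bounded above by `C|Λ|` for a constant `C` independent of `Λ`"; "`ν` is `μ`-regular is
  equivalent to `ν` is `μ'`-regular and we simply say that `ν` is regular".

## Contents

* `boxPhaseAt a n σ = ((q_{a+i})_{i≤n}, (p_{a+i})_{i≤n}) ∈ PhaseSpace (n+1)`, the restriction to
  the interval box `{a, …, a+n}` in the `(positions, momenta)` format of `P.hamiltonian`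
  (`FouriersLaw.lean`); measurability; the shift relation
  `boxPhaseAt (a+1) n = boxPhaseAt a n ∘ (σ ↦ σ(· + 1))` and, for shift-invariant `ν`, independence
  of the phase-space box marginals `ν ∘ (boxPhaseAt a n)⁻¹` from `a`.
* `OscillatorChain.IsRegularFinVol P ν` — for some temperature `T > 0` and finite `C`, for every
  interval box `Λ = {a, …, a+n}`:
  `H(ν ∘ (boxPhaseAt a n)⁻¹ | Z⁻¹ e^{-H_{n+1}/T} dq dp) ≤ C (n+1)`, `H_{n+1} = P.hamiltonian (n+1)`
  the free-ends Hamiltonian, the reference being Lebesgue measure on `PhaseSpace (n+1)` tilted by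
  `-H_{n+1}/T` (Mathlib `Measure.tilted`; syntactically `P.gibbsMeasure (n+1) T` of
  `LangevinChainGibbs.lean`, which is not imported to keep the cone small) and `H(·|·)` Mathlib's
  `InformationTheory.klDiv`. API: `isRegularFinVol_iff` (`Iff.rfl`, the form inlined in route
  statements), `isRegularFinVol_iff_boxPhaseAt`, finiteness of every box entropy, LOCAL ABSOLUTE
  CONTINUITY of regular states, NORMALISABILITY of the references forced by a non-zero regular
  state, the reduction to boxes based at `a = 0` for shift-invariant states, and `of_le`.

## Relation to `IsRegular` (Bernardin's form)

`InfiniteChain.IsRegular P ν` / `IsRegular P ν` of the sibling modules measure the box marginals of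
`ν` against those of an infinite-volume DLR Gibbs state of the chain; `IsRegularFinVol` measures
the phase-space box marginals against the finite-volume Gibbs states with FREE boundary
conditions (FFL's `λ_n⁰`). Bernardin notes that regularity does not depend on the reference
Gibbs ensemble and FFL work with exactly the free-boundary family; no implication between the
two Lean predicates is asserted here (for unbounded interactions the comparison involves boundary
energies and is not a formality). (Revision note: the first revision of this file also carried a
private copy of the vocabulary — `ChainConfig.{boxRestrict, IsLocalTestFunction, partialQ,
partialP, shift, IsShiftInvariant, boxRestrictAt, boxMarginal}`, `OscillatorChain.liouville`,
`OscillatorChain.IsLiouvilleStationary` —; it landed within minutes of the sibling modules and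
those unreferenced duplicates were withdrawn: one definition per notion.)

## Design notes

* Every definition has explicit binders (no `variable` sections), so that no `Prop`-valued
  definition here reads as a closed named fact.
* `IsRegularFinVol` is written with the box map INLINED, verbatim as in the requesting route
  statement, so that restatements match by `Iff.rfl`; `isRegularFinVol_iff_boxPhaseAt` is the
  same statement through the named map.
* `klDiv` is `∞` unless the first measure is absolutely continuous w.r.t. the second with
  integrable log-likelihood ratio, and `Measure.tilted` is the zero measure when `e^{-H/T}` is not
  integrable. Hence (proved below) a non-zero regular state forces finite partition functions and
  regular states are locally absolutely continuous: no satisfaction through junk values except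
  `ν = 0` (excluded in route statements by `IsProbabilityMeasure ν`); Dirac (periodic-orbit)
  states, stationary and shift invariant, are correctly NOT regular.
-/

noncomputable section

open MeasureTheory Filter Set InformationTheory
open scoped ENNReal

namespace Literature.MathematicalPhysics.KineticTheory.HeatConduction

/-! ### Phase-space box maps -/

/-- Restriction to the box `{a, …, a+n}` in the phase-space format of `FouriersLaw.lean`:
`σ ↦ ((q_{a+i})_{i ≤ n}, (p_{a+i})_{i ≤ n}) ∈ PhaseSpace (n+1)`, the argument of the free-boundary
Hamiltonian `P.hamiltonian (n+1)` (FFL's `ω_Λ = (p_Λ, q_Λ)`). [cite: FritzFunakiLebowitz1994, §2 p. 214] -/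
def boxPhaseAt (a : ℤ) (n : ℕ) (σ : ChainConfig) : PhaseSpace (n + 1) :=
  (fun i : Fin (n + 1) => (σ (a + i)).1, fun i : Fin (n + 1) => (σ (a + i)).2)

/-- `boxPhaseAt a n` is measurable (so its push-forwards are not junk). [folklore] -/
theorem measurable_boxPhaseAt (a : ℤ) (n : ℕ) : Measurable (boxPhaseAt a n) :=
  Measurable.prodMk (measurable_pi_lambda _ fun i => (measurable_pi_apply (a + (i : ℤ))).fst)
    (measurable_pi_lambda _ fun i => (measurable_pi_apply (a + (i : ℤ))).snd)

/-- Positions block of `boxPhaseAt`. [folklore] -/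
@[simp] theorem boxPhaseAt_fst (a : ℤ) (n : ℕ) (σ : ChainConfig) (i : Fin (n + 1)) :
    (boxPhaseAt a n σ).1 i = (σ (a + i)).1 := rfl

/-- Momenta block of `boxPhaseAt`. [folklore] -/
@[simp] theorem boxPhaseAt_snd (a : ℤ) (n : ℕ) (σ : ChainConfig) (i : Fin (n + 1)) :
    (boxPhaseAt a n σ).2 i = (σ (a + i)).2 := rfl

/-- The spatial shift `σ ↦ σ(· + 1)` is measurable (it is the `shift` of the sibling vocabulary
modules, written out). [folklore] -/
theorem measurable_shift_fun : Measurable fun (σ : ChainConfig) (x : ℤ) => σ (x + 1) :=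
  measurable_pi_lambda _ fun _ => measurable_pi_apply _

/-- Moving the box one step to the right is pre-composition with the shift. [folklore] -/
theorem boxPhaseAt_add_one (a : ℤ) (n : ℕ) :
    boxPhaseAt (a + 1) n = boxPhaseAt a n ∘ fun (σ : ChainConfig) (x : ℤ) => σ (x + 1) := by
  funext σ
  simp only [boxPhaseAt, Function.comp_apply, add_right_comm a 1 _]

/-- For a SHIFT-INVARIANT `ν` (hypothesis in unfolded form, definitionally the `IsShiftInvariant ν`
of the sibling modules) the phase-space box marginals do not depend on the position of the box:
one step. [folklore] -/
theorem map_boxPhaseAt_add_one_of_map_shift {ν : Measure ChainConfig}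
    (hν : ν.map (fun (σ : ChainConfig) (x : ℤ) => σ (x + 1)) = ν) (a : ℤ) (n : ℕ) :
    ν.map (boxPhaseAt (a + 1) n) = ν.map (boxPhaseAt a n) := by
  rw [boxPhaseAt_add_one, ← Measure.map_map (measurable_boxPhaseAt a n) measurable_shift_fun, hν]

/-- For a shift-invariant `ν` every phase-space box marginal equals the one based at `0`. [folklore] -/
theorem map_boxPhaseAt_eq_zero_of_map_shift {ν : Measure ChainConfig}
    (hν : ν.map (fun (σ : ChainConfig) (x : ℤ) => σ (x + 1)) = ν) (a : ℤ) (n : ℕ) :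
    ν.map (boxPhaseAt a n) = ν.map (boxPhaseAt 0 n) := by
  induction a using Int.induction_on with
  | zero => rfl
  | succ k ih => rw [← ih]; exact map_boxPhaseAt_add_one_of_map_shift hν (k : ℤ) n
  | pred k ih =>
      rw [← ih, ← map_boxPhaseAt_add_one_of_map_shift hν (-(k : ℤ) - 1) n]
      congr 2
      ring

/-! ### Regularity with respect to the free-boundary finite-volume Gibbs references -/

namespace OscillatorChain

/-- **Regularity with respect to the free-boundary finite-volume Gibbs references.** `ν` is
REGULAR: for some temperature `T > 0` and some finite constant `C`, for every interval box
`Λ = {a, …, a+n}` of `ℤ` the relative entropy (Mathlib `klDiv`) of the law under `ν` of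
`((q_{a+i})_{i≤n}, (p_{a+i})_{i≤n}) ∈ PhaseSpace (n+1)` with respect to the finite-volume Gibbs
state with FREE boundary conditions, `Z⁻¹ e^{-H_{n+1}(q,p)/T} dq dp` — Lebesgue measure on
`PhaseSpace (n+1)` tilted by `-H_{n+1}/T`, `H_{n+1} = P.hamiltonian (n+1)` the free-ends
Hamiltonian — is at most `C (n+1) = C|Λ|`. Reference family = FFL's `λ_n⁰` ("finite volume Gibbs
states with free boundary conditions", eq. (2.7), entropy of Definition 2.4), bound linear in the
volume for EVERY box as in Bernardin's "`μ`-regular" (whose reference is an infinite-volume Gibbs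
ensemble restricted to `Λ`; "`ν` is `μ`-regular is equivalent to `ν` is `μ'`-regular"). The map
is inlined verbatim as in the requesting route statements (`Iff.rfl` restatements); it is
`boxPhaseAt a n` (`isRegularFinVol_iff_boxPhaseAt`).
[cite: FritzFunakiLebowitz1994, §2 eq. (2.7) and Def. 2.4] -/
def IsRegularFinVol (P : OscillatorChain) (ν : Measure ChainConfig) : Prop :=
  ∃ (T : ℝ) (C : ℝ≥0∞), 0 < T ∧ C ≠ ⊤ ∧ ∀ (a : ℤ) (n : ℕ),
    klDiv (ν.map fun σ => ((fun i : Fin (n+1) => (σ (a + i)).1), (fun i : Fin (n+1) => (σ (a + i)).2)))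
      ((volume : Measure (PhaseSpace (n+1))).tilted fun x => -(P.hamiltonian (n+1) x) / T) ≤ C * (n + 1)

/-! #### API -/

/-- Unfolding `IsRegularFinVol` (the form inlined in route statements). [folklore] -/
theorem isRegularFinVol_iff (P : OscillatorChain) (ν : Measure ChainConfig) :
    P.IsRegularFinVol ν ↔
      ∃ (T : ℝ) (C : ℝ≥0∞), 0 < T ∧ C ≠ ⊤ ∧ ∀ (a : ℤ) (n : ℕ),
        klDiv (ν.map fun σ => ((fun i : Fin (n+1) => (σ (a + i)).1),
            (fun i : Fin (n+1) => (σ (a + i)).2)))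
          ((volume : Measure (PhaseSpace (n+1))).tilted fun x => -(P.hamiltonian (n+1) x) / T) ≤
            C * (n + 1) :=
  Iff.rfl

/-- `IsRegularFinVol` through the named box map `boxPhaseAt`. [folklore] -/
theorem isRegularFinVol_iff_boxPhaseAt (P : OscillatorChain) (ν : Measure ChainConfig) :
    P.IsRegularFinVol ν ↔
      ∃ (T : ℝ) (C : ℝ≥0∞), 0 < T ∧ C ≠ ⊤ ∧ ∀ (a : ℤ) (n : ℕ),
        klDiv (ν.map (boxPhaseAt a n))
          ((volume : Measure (PhaseSpace (n+1))).tilted fun x => -(P.hamiltonian (n+1) x) / T) ≤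
            C * (n + 1) :=
  Iff.rfl

/-- The linear entropy bound is finite on every box. [folklore] -/
theorem IsRegularFinVol.klDiv_ne_top {P : OscillatorChain} {ν : Measure ChainConfig}
    (h : P.IsRegularFinVol ν) :
    ∃ T : ℝ, 0 < T ∧ ∀ (a : ℤ) (n : ℕ),
      klDiv (ν.map (boxPhaseAt a n))
        ((volume : Measure (PhaseSpace (n+1))).tilted fun x => -(P.hamiltonian (n+1) x) / T) ≠ ⊤ := by
  obtain ⟨T, C, hT, hC, hb⟩ := (P.isRegularFinVol_iff_boxPhaseAt ν).1 h
  refine ⟨T, hT, fun a n => ne_top_of_le_ne_top ?_ (hb a n)⟩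
  exact ENNReal.mul_ne_top hC (by simp)

/-- **Regular states are locally absolutely continuous**: every phase-space box marginal of a
regular `ν` is absolutely continuous with respect to the finite-volume Gibbs reference (hence
w.r.t. Lebesgue measure), because `klDiv μ ν = ∞` unless `μ ≪ ν` (FFL: "`I_n[μ] < +∞` implies
that `μ_n ≪ λ_n⁰`"). [cite: FritzFunakiLebowitz1994, §2 (after Def. 2.4)] -/
theorem IsRegularFinVol.absolutelyContinuous {P : OscillatorChain} {ν : Measure ChainConfig}
    (h : P.IsRegularFinVol ν) :
    ∃ T : ℝ, 0 < T ∧ ∀ (a : ℤ) (n : ℕ),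
      ν.map (boxPhaseAt a n) ≪
        (volume : Measure (PhaseSpace (n+1))).tilted fun x => -(P.hamiltonian (n+1) x) / T := by
  obtain ⟨T, hT, hb⟩ := h.klDiv_ne_top
  refine ⟨T, hT, fun a n => ?_⟩
  by_contra hac
  exact hb a n (klDiv_of_not_ac hac)

/-- Local absolute continuity with respect to Lebesgue measure on `PhaseSpace (n+1)`. [folklore] -/
theorem IsRegularFinVol.absolutelyContinuous_volume {P : OscillatorChain}
    {ν : Measure ChainConfig} (h : P.IsRegularFinVol ν) (a : ℤ) (n : ℕ) :
    ν.map (boxPhaseAt a n) ≪ (volume : Measure (PhaseSpace (n+1))) := by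
  obtain ⟨T, -, hb⟩ := h.absolutelyContinuous
  exact (hb a n).trans (tilted_absolutelyContinuous _ _)

/-- **A non-zero regular state forces normalisable references**: if `ν ≠ 0` is regular with
temperature parameter `T`, then `e^{-H_{n+1}/T}` is Lebesgue integrable on every `PhaseSpace (n+1)`
(otherwise Mathlib's tilted measure is `0` and `klDiv μ 0 = ∞` for `μ ≠ 0`) — the free-boundary
form of LLL's normalisability condition B2; in particular the predicate is not satisfied through
junk values. [folklore] -/
theorem IsRegularFinVol.integrable_exp_neg_hamiltonian_div {P : OscillatorChain}
    {ν : Measure ChainConfig} (h : P.IsRegularFinVol ν) (hν : ν ≠ 0) :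
    ∃ T : ℝ, 0 < T ∧ ∀ n : ℕ,
      Integrable (fun x : PhaseSpace (n + 1) => Real.exp (-(P.hamiltonian (n + 1) x) / T))
        (volume : Measure (PhaseSpace (n + 1))) := by
  obtain ⟨T, hT, hb⟩ := h.klDiv_ne_top
  refine ⟨T, hT, fun n => ?_⟩
  by_contra hint
  have h0 := hb 0 n
  rw [tilted_of_not_integrable hint] at h0
  haveI : NeZero (ν.map (boxPhaseAt 0 n)) :=
    ⟨fun hz => hν ((Measure.map_eq_zero_iff (measurable_boxPhaseAt 0 n).aemeasurable).1 hz)⟩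
  exact h0 klDiv_zero_right

/-- For a SHIFT-INVARIANT state (hypothesis in unfolded form, definitionally the
`IsShiftInvariant ν` of the sibling vocabulary modules) regularity needs to be checked on the
boxes `{0, …, n}` only. [folklore] -/
theorem isRegularFinVol_iff_of_map_shift (P : OscillatorChain) {ν : Measure ChainConfig}
    (hν : ν.map (fun (σ : ChainConfig) (x : ℤ) => σ (x + 1)) = ν) :
    P.IsRegularFinVol ν ↔
      ∃ (T : ℝ) (C : ℝ≥0∞), 0 < T ∧ C ≠ ⊤ ∧ ∀ n : ℕ,
        klDiv (ν.map (boxPhaseAt 0 n))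
          ((volume : Measure (PhaseSpace (n+1))).tilted fun x => -(P.hamiltonian (n+1) x) / T) ≤
            C * (n + 1) := by
  rw [isRegularFinVol_iff_boxPhaseAt]
  constructor
  · rintro ⟨T, C, hT, hC, hb⟩
    exact ⟨T, C, hT, hC, fun n => hb 0 n⟩
  · rintro ⟨T, C, hT, hC, hb⟩
    refine ⟨T, C, hT, hC, fun a n => ?_⟩
    rw [map_boxPhaseAt_eq_zero_of_map_shift hν a n]
    exact hb n

/-- Monotonicity of the regularity bound in the constant: any larger finite constant works (used
to merge witnesses). [folklore] -/
theorem IsRegularFinVol.of_le {P : OscillatorChain} {ν : Measure ChainConfig} {T : ℝ}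
    {C C' : ℝ≥0∞} (hT : 0 < T) (hC' : C' ≠ ⊤) (hCC' : C ≤ C')
    (hb : ∀ (a : ℤ) (n : ℕ), klDiv (ν.map (boxPhaseAt a n))
      ((volume : Measure (PhaseSpace (n+1))).tilted fun x => -(P.hamiltonian (n+1) x) / T) ≤
        C * (n + 1)) :
    P.IsRegularFinVol ν :=
  (P.isRegularFinVol_iff_boxPhaseAt ν).2
    ⟨T, C', hT, hC', fun a n => (hb a n).trans (by gcongr)⟩

end OscillatorChain

end Literature.MathematicalPhysics.KineticTheory.HeatConduction

end
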